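import Summits.NavierStokesRegularity.NavierStokesRegularity.Theses.PlaneEnergyCeiling
import Summits.NavierStokesRegularity.NavierStokesRegularity.Theorems.PlaneEnergyCeilingBoundedPlanarEnergyRegularityStubPlanarEnergyZoom
import Summits.NavierStokesRegularity.NavierStokesRegularity.Theorems.PlaneEnergyCeilingBoundedPlanarEnergyRegularityGlue

/-!
# Route PlaneEnergyCeiling · crux `BoundedPlanarEnergyRegularity` — reduced to the Liouville item

With the zoom stub `stub_planarEnergyZoom` (= support item stmt-16858) proved and the per-datum
local Clay theory `stub_localClayTheory` landed, the birth composition of the crux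
`BoundedPlanarEnergyRegularity` (stmt-NavierStokesRegularity-16921) has exactly ONE open input left:
Liouville in the planar-energy class (`PlanarEnergyLiouville`, stmt-NavierStokesRegularity-16856,
an open problem). This file records the reduction as a theorem over the route decls:
`boundedPlanarEnergyRegularity_of_liouville : PlanarEnergyLiouville → BoundedPlanarEnergyRegularity`.
Consequently the route's deciding theorem `closes` needs only `PlanarEnergyAPriori` and
`PlanarEnergyLiouville` (its third hypothesis `PlanarEnergyZoomA` is now a theorem,
`planeEnergyCeiling_planarEnergyZoomA`).
-/

-- single-conjunct summit: `Summit.<Summit>.<Problem>` repeats the name by the D-0017 layout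
set_option linter.dupNamespace false

namespace Summit.NavierStokesRegularity.NavierStokesRegularity.Theorems.BoundedPlanarEnergyRegularity

/-- **The crux from the Liouville item alone**: `PlanarEnergyLiouville → BoundedPlanarEnergyRegularity`
(birth composition with the zoom `stub_planarEnergyZoom` and the local Clay theory discharged:
`boundedPlanarEnergyRegularity_of_liouville_zoom`). -/
theorem boundedPlanarEnergyRegularity_of_liouville :
    Summit.NavierStokesRegularity.NavierStokesRegularity.Theses.PlaneEnergyCeiling.PlanarEnergyLiouville →
      Summit.NavierStokesRegularity.NavierStokesRegularity.Theses.PlaneEnergyCeiling.BoundedPlanarEnergyRegularity :=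
  fun hL => boundedPlanarEnergyRegularity_of_liouville_zoom hL stub_planarEnergyZoom

end Summit.NavierStokesRegularity.NavierStokesRegularity.Theorems.BoundedPlanarEnergyRegularity
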